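import Literature.Probability.Percolation.QuadCrossingContinuityReduction
import Literature.Probability.Percolation.QuadCrossingRawClosed
import Literature.Probability.Percolation.QuadCrossingSubquadTopology
import Literature.Probability.Percolation.QuadCrossingSubquadArm
import Literature.Probability.Percolation.QuadCrossingDuality
import Literature.Probability.Percolation.QuadCrossingPathReparam
import Literature.Probability.Percolation.DualFaceChains
import Literature.Probability.Percolation.AnnulusCrossingBoundProofs
import Literature.Probability.Percolation.QuadCrossingContinuityCaseTwoSmall
import HarnessLib

/-!
# Schramm–Smirnov's Lemma 6.1, case (3) with `d₀ ≤ δ`: the crossing events differ with small probability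

Topic `Probability/Percolation`; proofs file towards the named fact `SchrammSmirnov2011_lemma_6_1`
(`QuadCrossingContinuity.lean`; O. Schramm, S. Smirnov, *On the scaling limits of planar
percolation*, Ann. Probab. 39 (2011), arXiv:1101.5820, §6).  Case (3) of the printed lemma (the
inner quad `Q'` shares `∂₁Q`, has `∂₀Q' ⊆ ∂₀Q`, `∂₂Q' ⊆ ∂₂Q`, and a free side `∂₃Q'` every point of
which is joined to `∂₃Q` by a path of diameter `≤ δ`) "is easily obtained by considering the dual
closed crossing from `∂₁` to `∂₃` and applying case (2)" (p. 23).  Here we carry this out for the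
sub-case which needs no lowest crossing — the dual counterpart of case (2)(ii), eq. (6.3) — for
critical bond percolation on `δℤ²`, end to end (perturbation size `ρ`, mesh `η`, edge length
`δ' = η√2`):

* `⊞_{Q'} ⊆ ⊞_Q` (`Quad.IsCrossing.of_subquad`), so `⊞_Q Δ ⊞_{Q'} = ⊞_Q ∖ ⊞_{Q'} ⊆ ¬⊞_{Q'}`;
* **duality** (`Quad.exists_path_avoiding_of_not_exists_isCrossing`, `QuadCrossingDuality.lean`): on
  `¬⊞_{Q'}` some path in `[Q']` joins `∂₁Q' = ∂₁Q` to `∂₃Q'` off the open edges;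
* `Quad.mem_annulusDualCrossing_of_path_avoiding_inner` — such a dual crossing of the inner quad,
  followed by its short junction to `∂₃Q`, joins `∂₁Q` to `∂₃Q` inside `[Q]`, hence meets a
  transversal `τ` from `∂₀Q` to `∂₂Q` of diameter `< 2 d₀(Q) ≤ 2ρ` (crossing lemma
  `Quad.exists_mem_of_isPreconnected_crossing'`) and has diameter `≥ d₁(Q)` (`Quad.sideDist_le`): it
  crosses an annulus around the foot of `τ`, and its lattice shadow is a dual-open chain
  (`mem_annulusDualCrossing_of_path`, `DualFaceChains.lean`);
* the RSW bound for closed crossings `annulusDualCrossing_half_le_holds` (self-duality,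
  `AnnulusCrossingBoundProofs.lean`).

Result (`real_symmDiff_crossedEvent_le_of_isPerturbationThree_of_sideDist_zero_le`): there are
`α, C, c > 0` such that whenever `Q.IsPerturbationThree Q' ρ`, `0 < ρ ≤ c · d₁(Q)` and `d₀(Q) ≤ ρ`,
then for all meshes `0 < η < ρ`, `μ_η(⊞_Q Δ ⊞_{Q'}) ≤ (C ρ / d₁(Q))^α`.

## References

* O. Schramm, S. Smirnov, Ann. Probab. 39 (2011) 1768–1814, arXiv:1101.5820, proof of Lemma 6.1,
  case (3) and case (2) (ii), eqs. (6.1), (6.3). [SchrammSmirnov2011]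
* G. Grimmett, *Percolation*, 2nd ed. (1999), §11.8. [GrimmettPercolation1999]
-/

noncomputable section

open scoped unitInterval
open Set Filter Metric Function MeasureTheory
open _root_.Topology
open Literature.Probability.LatticeModels

namespace Literature.Probability.Percolation

namespace QuadCrossing

variable {D : Set ℂ}

/-- The closed annulus-crossing event grows with the inner radius. [folklore] -/
theorem annulusDualCrossing_mono_left (x : ℂ) (δ : ℝ) {r r' : ℝ} (h : r ≤ r') (R : ℝ) :
    annulusDualCrossing x δ r R ⊆ annulusDualCrossing x δ r' R := fun _ hω =>
  annulusOpenCrossing_mono_left x δ h R hω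

namespace Quad

variable {Q Q' : Quad D} {δ : ℝ} {ω : BondConfig (Site 2)}

/-- A transversal of `Q` from `∂₀Q` to `∂₂Q` of diameter `< 2 d₀(Q)` (the infimum `d₀(Q) > 0` is
approached). [cite: SchrammSmirnov2011, Lemma 6.1] -/
theorem exists_transversal_zero_diam_lt (Q : Quad D) :
    ∃ x₀ ∈ Q.side 0, ∃ x₂ ∈ Q.side 2, ∃ τ : Path x₀ x₂, range τ ⊆ Q.carrier ∧
      Metric.diam (range τ) < 2 * Q.sideDist 0 := by
  have hpos := Q.sideDist_pos 0
  have hlt : Q.sideDist 0 < 2 * Q.sideDist 0 := by linarith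
  rw [Q.sideDist_eq 0] at hlt
  obtain ⟨r, ⟨x, hx, y, hy, τ, hτ, rfl⟩, hr⟩ := exists_lt_of_csInf_lt (Q.nonempty_sideDistSet 0) hlt
  rw [← Q.sideDist_eq 0] at hr
  exact ⟨x, hx, y, hy, τ, hτ, hr⟩

/-- **A dual crossing of the inner quad crosses an annulus around the foot of any transversal**
(the dual counterpart of eq. (6.1), for case (3) of Schramm–Smirnov's Lemma 6.1).  Let
`[Q'] ⊆ [Q]`, `∂₁Q' ⊆ ∂₁Q`, and let every point of `∂₃Q'` be joined to `∂₃Q` by a path in `[Q]` of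
diameter `≤ ρ` (`0 ≤ ρ`).  Let `τ` be a path in `[Q]` from `x₀ ∈ ∂₀Q` to `∂₂Q` with `diam τ ≤ D₁`, and
let `D₁ + ρ + 2δ ≤ R`, `2R < d₁(Q) - ρ`.  If some path `β` in `[Q']` joins `∂₁Q'` to `∂₃Q'` off the drawn
open edges of `δℤ²` (`δ > 0`), then `ω ∈ annulusDualCrossing x₀ δ (D₁ + ρ + 2δ) (R - 2δ)`: `β` followed
by the short junction `α` to `∂₃Q` joins `∂₁Q` to `∂₃Q` inside `[Q]`, hence meets `τ` (so `β` passes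
within `D₁ + ρ` of `x₀`) and has diameter `≥ d₁(Q)` (so `β`, of diameter `> 2R`, leaves `B(x₀, R)`);
the piece of `β` up to its first exit is shadowed by a dual-open chain of faces.
[cite: SchrammSmirnov2011, proof of Lemma 6.1, case (3) via case (2), eq. (6.1)] -/
theorem mem_annulusDualCrossing_of_path_avoiding_inner (hδ : 0 < δ) {ρ : ℝ} (hρ : 0 ≤ ρ)
    (hcar : Q'.carrier ⊆ Q.carrier) (h1 : Q'.side 1 ⊆ Q.side 1)
    (hjoin : ∀ y ∈ Q'.side 3, Q.ShortJoin ρ y (Q.side 3))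
    {x₀ x₂ : ℂ} (hx₀ : x₀ ∈ Q.side 0) (hx₂ : x₂ ∈ Q.side 2) (τ : Path x₀ x₂)
    (hτ : range τ ⊆ Q.carrier) {D₁ : ℝ} (hD₁ : Metric.diam (range τ) ≤ D₁)
    {R : ℝ} (hR2 : 2 * R < Q.sideDist 1 - ρ) (hRδ : D₁ + ρ + 2 * δ ≤ R)
    {β : ℝ → ℂ} (hβc : ContinuousOn β (Icc 0 1)) (hβQ' : MapsTo β (Icc 0 1) Q'.carrier)
    (hβ0 : β 0 ∈ Q'.side 1) (hβ1 : β 1 ∈ Q'.side 3)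
    (hβO : ∀ t ∈ Icc (0 : ℝ) 1, β t ∉ openEdgeUnion δ ω) :
    ω ∈ annulusDualCrossing x₀ δ (D₁ + ρ + 2 * δ) (R - 2 * δ) := by
  -- `β` as a path `p`, inside `[Q]`
  obtain ⟨p, hp⟩ := exists_path_of_continuousOn hβc
  have hpr : range p = β '' Icc 0 1 := by
    ext z
    constructor
    · rintro ⟨t, rfl⟩; exact ⟨t, t.2, (hp t).symm⟩
    · rintro ⟨t, ht, rfl⟩; exact ⟨⟨t, ht⟩, hp ⟨t, ht⟩⟩
  have hpQ : range p ⊆ Q.carrier := by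
    rw [hpr]; rintro _ ⟨t, ht, rfl⟩; exact hcar (hβQ' ht)
  -- the short junction `α` from `β 1 ∈ ∂₃Q'` to `∂₃Q`
  obtain ⟨y₃, hy₃, α, hα, hαdiam⟩ := hjoin (β 1) hβ1
  have hs : β 0 ∈ Q.side 1 := h1 hβ0
  -- `β` passes within `D₁ + ρ` of `x₀`
  have hnear : ∃ u ∈ range p, dist u x₀ ≤ D₁ + ρ := by
    set L : Set ℂ := range p ∪ range α with hL
    have hLc : IsCompact L := (isCompact_range p.continuous).union (isCompact_range α.continuous)
    have hLconn : IsConnected L :=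
      (isConnected_range p.continuous).union ⟨β 1, ⟨1, p.target⟩, ⟨0, α.source⟩⟩
        (isConnected_range α.continuous)
    have hLsub : L ⊆ Q.carrier := union_subset hpQ hα
    have hL1 : (L ∩ Q.side 1).Nonempty := ⟨β 0, Or.inl ⟨0, p.source⟩, hs⟩
    have hL3 : (L ∩ Q.side 3).Nonempty := ⟨y₃, Or.inr ⟨1, α.target⟩, hy₃⟩
    obtain ⟨t, -, ht⟩ := Q.exists_mem_of_isPreconnected_crossing' hLc hLconn.isPreconnected hLsub
      hL1 hL3 τ.continuous_extend.continuousOn (fun s _ => hτ (by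
        exact ⟨projIcc 0 1 zero_le_one s, rfl⟩)) (by rw [τ.extend_zero]; exact hx₀)
      (by rw [τ.extend_one]; exact hx₂)
    have hwτ : τ.extend t ∈ range τ := ⟨projIcc 0 1 zero_le_one t, rfl⟩
    have hw : dist (τ.extend t) x₀ ≤ D₁ :=
      (dist_le_diam_of_mem (isCompact_range τ.continuous).isBounded hwτ ⟨0, τ.source⟩).trans hD₁
    rcases ht with hmem | hmem
    · exact ⟨τ.extend t, hmem, by linarith⟩
    · refine ⟨β 1, ⟨1, p.target⟩, ?_⟩
      have hyw : dist (β 1) (τ.extend t) ≤ ρ :=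
        (dist_le_diam_of_mem (isCompact_range α.continuous).isBounded ⟨0, α.source⟩ hmem).trans hαdiam
      linarith [dist_triangle (β 1) (τ.extend t) x₀]
  -- `β` has diameter `≥ d₁(Q) - ρ > 2R`, so it leaves `B(x₀, R)`
  have hdiam : Q.sideDist 1 - ρ ≤ Metric.diam (range p) := by
    have h1' : Q.sideDist 1 ≤ Metric.diam (range (p.trans α)) :=
      Quad.sideDist_le (j := 1) hs hy₃ (p.trans α) (by rw [Path.trans_range]; exact union_subset hpQ hα)
    rw [Path.trans_range] at h1'
    have h2 : Metric.diam (range p ∪ range α) ≤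
        Metric.diam (range p) + dist (β 1) (β 1) + Metric.diam (range α) :=
      Metric.diam_union ⟨1, p.target⟩ ⟨0, α.source⟩
    rw [dist_self, add_zero] at h2
    linarith
  have hD₁nn : (0 : ℝ) ≤ D₁ := Metric.diam_nonneg.trans hD₁
  have hfar : ∃ v ∈ range p, R ≤ dist v x₀ := by
    by_contra hcon
    push Not at hcon
    have : Metric.diam (range p) ≤ 2 * R := by
      refine Metric.diam_le_of_forall_dist_le (by linarith) fun u hu v hv => ?_
      linarith [dist_triangle u x₀ v, hcon u hu, hcon v hv, dist_comm x₀ v]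
    linarith
  obtain ⟨_, ⟨s₀, rfl⟩, hu⟩ := hnear
  obtain ⟨_, ⟨s₁, rfl⟩, hv⟩ := hfar
  -- the piece of `p` from `s₀` to `s₁`, up to its first exit from `B(x₀, R)`
  set γ : ℝ → ℂ := fun t => p.extend ((s₀ : ℝ) + t * ((s₁ : ℝ) - s₀)) with hγ
  have hγc : Continuous γ := p.continuous_extend.comp (by fun_prop)
  have hγ0 : γ 0 = p s₀ := by simp [hγ]
  have hγ1 : γ 1 = p s₁ := by simp [hγ]
  have hγmem : ∀ t, γ t ∈ range p := fun t => ⟨projIcc 0 1 zero_le_one _, rfl⟩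
  have hpO : ∀ z ∈ range p, z ∉ openEdgeUnion δ ω := by
    rw [hpr]; rintro _ ⟨t, ht, rfl⟩; exact hβO t ht
  obtain ⟨γ', hγ'c, hγ'0, hγ'mem, hγ'R, hγ'1⟩ := exists_restrict_until_dist_ge (γ := γ) (x := x₀)
    (R := R) hγc.continuousOn (by rw [hγ0]; linarith) (by rw [hγ1]; exact hv)
  have hγ'p : ∀ t ∈ Icc (0 : ℝ) 1, γ' t ∈ range p := fun t ht => by
    obtain ⟨s, -, hs'⟩ := hγ'mem t ht
    rw [← hs']
    exact hγmem s
  exact mem_annulusDualCrossing_of_path hδ x₀ hγ'c (fun t ht => hpO _ (hγ'p t ht))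
    (by rw [hγ'0, hγ0]; exact hu) hγ'R hγ'1 hRδ

end Quad

/-- **Lemma 6.1, case (3), sub-case `d₀ ≤ ρ`** (the dual counterpart of Schramm–Smirnov's case (2)
(ii), eq. (6.3)), for critical bond percolation on `δℤ²`: there are `α, C, c > 0` such that whenever
`Q.IsPerturbationThree Q' ρ`, `0 < ρ ≤ c · d₁(Q)` and `d₀(Q) ≤ ρ`, then for every mesh `0 < η < ρ`,
`μ_η(⊞_Q Δ ⊞_{Q'}) ≤ (C ρ / d₁(Q))^α`.  Proof: `⊞_{Q'} ⊆ ⊞_Q`; on `¬⊞_{Q'}` duality gives a dual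
crossing of `Q'` from `∂₁Q` to `∂₃Q'`, which crosses the annulus `A(x₀; 3ρ + 2δ', d₁/16 - 2δ')`
around the foot `x₀` of a transversal of diameter `< 2ρ` (`δ' = η√2`); RSW for closed crossings.
[cite: SchrammSmirnov2011, proof of Lemma 6.1, case (3) via case (2) (ii), eq. (6.3)] -/
theorem real_symmDiff_crossedEvent_le_of_isPerturbationThree_of_sideDist_zero_le :
    ∃ α C c : ℝ, 0 < α ∧ 0 < C ∧ 0 < c ∧
      ∀ (D : Set ℂ) (Q Q' : Quad D) (ρ : ℝ), 0 < ρ → ρ ≤ c * Q.sideDist 1 →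
        Q.IsPerturbationThree Q' ρ → Q.sideDist 0 ≤ ρ →
          ∀ η : ℝ, 0 < η → η < ρ →
            (squareCrossingLaw D η : Measure (QuadConfig D)).real
                (symmDiff (QuadConfig.crossedEvent Q) (QuadConfig.crossedEvent Q')) ≤
              (C * ρ / Q.sideDist 1) ^ α := by
  obtain ⟨α, c₀, hα, hc₀, hRSW⟩ := annulusDualCrossing_half_le_holds
  set C₁ : ℝ := 7 + 2 * c₀ with hC₁
  have hC₁pos : 0 < C₁ := by rw [hC₁]; linarith
  refine ⟨α, 32 * C₁, 1 / (128 * (C₁ + 1)), hα, by positivity, by positivity, ?_⟩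
  intro D Q Q' ρ hρ hρc h3 hd0 η hη hηρ
  obtain ⟨hcar, h0, h1, h2, hjoin⟩ := h3
  set d₁ := Q.sideDist 1 with hd₁
  have hd₁pos : 0 < d₁ := Q.sideDist_pos 1
  -- the regime: `ρ ≤ d₁ / (128 (C₁ + 1))`
  have hρd : 128 * (C₁ + 1) * ρ ≤ d₁ := by
    have := hρc
    rw [div_mul_eq_mul_div, one_mul, le_div_iff₀ (by positivity)] at this
    linarith
  -- the mesh `δ' = η √2 < 2ρ`
  set δ' : ℝ := η * Real.sqrt 2 with hδ'
  have hδ'pos : 0 < δ' := mul_pos hη (Real.sqrt_pos.2 (by norm_num))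
  have hsqrt2 : Real.sqrt 2 < 2 := by
    rw [show (2 : ℝ) = Real.sqrt 4 by rw [show (4 : ℝ) = 2 ^ 2 by norm_num, Real.sqrt_sq (by norm_num)]]
    exact Real.sqrt_lt_sqrt (by norm_num) (by norm_num)
  have hδ'ρ : δ' < 2 * ρ := by
    calc δ' = η * Real.sqrt 2 := rfl
      _ < ρ * 2 := mul_lt_mul'' hηρ hsqrt2 hη.le (Real.sqrt_nonneg _)
      _ = 2 * ρ := by ring
  -- Step 1: the law is bounded by the `P_{1/2}`-probability of the symmetric difference
  refine (real_squareCrossingLaw_symmDiff_le D η Q Q').trans ?_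
  -- Step 2: the discrete events; `⊞_{Q'} ⊆ ⊞_Q`, so the symmetric difference is inside `¬⊞_{Q'}`
  set A : Set (BondConfig (Site 2)) := {ω | Q ∈ z2QuadConfig D δ' ω} with hA
  set B : Set (BondConfig (Site 2)) := {ω | Q' ∈ z2QuadConfig D δ' ω} with hB
  have hBA : B ⊆ A := fun ω hω => by
    rw [hB, mem_setOf_eq, mem_z2QuadConfig_iff_exists_isCrossing hδ'pos] at hω
    obtain ⟨K, hK, hKO⟩ := hω
    rw [hA, mem_setOf_eq, mem_z2QuadConfig_iff_exists_isCrossing hδ'pos]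
    exact ⟨K, Quad.IsCrossing.of_subquad hcar h0 h2 hK, hKO⟩
  have hsymm : symmDiff A B ⊆ Bᶜ := by
    intro ω hω
    rcases (Set.mem_symmDiff).1 hω with ⟨-, hωB⟩ | ⟨hωB, hωA⟩
    · exact hωB
    · exact absurd (hBA hωB) hωA
  -- Step 3: on `¬⊞_{Q'}`, a dual crossing of `Q'`, hence a closed arm around the foot of a transversal
  obtain ⟨x₀, hx₀, x₂, hx₂, τ, hτ, hτdiam⟩ := Q.exists_transversal_zero_diam_lt
  have hD₁ : Metric.diam (range τ) ≤ 2 * ρ := by linarith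
  set R : ℝ := d₁ / 16 with hR
  have hR2 : 2 * R < Q.sideDist 1 - ρ := by rw [hR]; nlinarith
  have hRδ : 2 * ρ + ρ + 2 * δ' ≤ R := by rw [hR]; nlinarith
  set r'' : ℝ := max (2 * ρ + ρ + 2 * δ') (c₀ * δ') with hr''
  have hBE : Bᶜ ⊆ annulusDualCrossing x₀ δ' r'' (R - 2 * δ') := fun ω hω => by
    have hω' : ¬ ∃ K, Q'.IsCrossing K ∧ K ⊆ openEdgeUnion δ' ω := by
      rw [hB] at hω
      simpa only [mem_compl_iff, mem_setOf_eq, mem_z2QuadConfig_iff_exists_isCrossing hδ'pos] using hω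
    obtain ⟨β, hβc, hβQ', hβ0, hβ1, hβO⟩ := Q'.exists_path_avoiding_of_not_exists_isCrossing hδ'pos hω'
    exact annulusDualCrossing_mono_left x₀ δ' (le_max_left _ _) _
      (Quad.mem_annulusDualCrossing_of_path_avoiding_inner hδ'pos hρ.le hcar h1.le hjoin hx₀ hx₂ τ hτ hD₁
        hR2 hRδ hβc hβQ' hβ0 hβ1 fun t ht => (hβO t ht).1)
  -- Step 4: RSW for closed crossings
  have hr''δ : c₀ * δ' ≤ r'' := le_max_right _ _
  have hr''le : r'' ≤ C₁ * ρ := by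
    rw [hr'', max_le_iff, hC₁]
    constructor
    · nlinarith
    · nlinarith [hc₀]
  have hR'ge : d₁ / 32 ≤ R - 2 * δ' := by rw [hR]; nlinarith
  have h2r : 2 * r'' ≤ R - 2 * δ' := by nlinarith
  have hRSW' := hRSW x₀ δ' r'' (R - 2 * δ') hδ'pos hr''δ h2r
  -- Step 5: assemble
  have hmono : (bondPercolation (zdGraph 2) half).real (symmDiff A B) ≤
      (bondPercolation (zdGraph 2) half).real (annulusDualCrossing x₀ δ' r'' (R - 2 * δ')) :=
    measureReal_mono (hsymm.trans hBE) (measure_ne_top _ _)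
  refine hmono.trans (hRSW'.trans ?_)
  have hbase : r'' / (R - 2 * δ') ≤ 32 * C₁ * ρ / d₁ := by
    rw [div_le_div_iff₀ (by linarith) hd₁pos]
    calc r'' * d₁ ≤ C₁ * ρ * d₁ := by nlinarith
      _ = 32 * C₁ * ρ * (d₁ / 32) := by ring
      _ ≤ 32 * C₁ * ρ * (R - 2 * δ') := by
          apply mul_le_mul_of_nonneg_left hR'ge; positivity
  have hr''nn : 0 ≤ r'' / (R - 2 * δ') := div_nonneg (le_trans (by positivity) hr''δ) (by linarith)
  exact Real.rpow_le_rpow hr''nn hbase hα.le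

end QuadCrossing

end Literature.Probability.Percolation
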